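import Mathlib
import Summits.ValiantsHypothesis.ValiantsHypothesis.Theorems.LacunarySymmetroidMatrixDescartesCensusIntervalParity

/-!
# `MatrixDescartes` (stmt-ValiantsHypothesis-18050), line «definite-pair-fold-law» — stub `stub_morse`, part 1:
continuous sorted simple roots of a one-parameter family of real-rooted polynomials

Generic real-analysis lemmas used by the Morse inequality `stub_morse` of the line
`Cruxes/MatrixDescartes/Lines/definite_pair_fold_law.lean` (val-idea-2 g2).  The line's proof plan asks for the
regularity of the generalized-eigenvalue branches `y_j(x)` of a definite pair; we avoid the implicit function
theorem and analytic branches altogether and work with the SORTED distinct real roots of a family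
`x ↦ ψ x ∈ ℝ[X]` whose members have `m` distinct real roots and degree `m`:

* `eval_mul_leadingCoeff_mul_neg_one_pow_pos` — sign of `ψ(Y)` off the roots is `sign lc(ψ) · (-1)^{#roots > Y}`;
* `eval_mul_eval_neg_of_separated` — hence `ψ` changes sign across each (simple) root;
* `exists_sortedRoots` — a sorted enumeration `y : Fin m → ℝ → ℝ` of the roots on a parameter set `U`;
* `continuousAt_sortedRoots` — if `x ↦ (ψ x).eval t` is continuous for every fixed `t` (separate continuity is
  enough) then every sorted root `x ↦ y j x` is continuous on the open set `U` (IVT bracketing: the `m` sign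
  changes at `x₀` persist for nearby `x`, giving `m` roots in `m` disjoint small intervals, which must be all of
  them).

The intermediate value step is the tree's `Census.exists_root_Ioo_of_mul_neg`.  Helper mode
(`--supports stmt-ValiantsHypothesis-18050`); no definitions are introduced.  Honest framing: pure
bookkeeping towards `stub_morse`; the law `stub_foldLaw`, Conjecture B, the crux `MatrixDescartes` and VP ≠ VNP are
OPEN and NOT moved by this file.
-/

set_option linter.dupNamespace false

namespace Summit.ValiantsHypothesis.ValiantsHypothesis.Theorems.LacunarySymmetroidMatrixDescartes.FoldLaw.Morse

open Polynomial Filter Topology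
open scoped BigOperators

/-! ### Real-rooted polynomials with simple roots -/

/-- A real polynomial of degree `m` with `m` distinct roots has a `Nodup` root multiset of cardinality `m`. -/
theorem roots_nodup_card {f : ℝ[X]} {m : ℕ} (hdeg : f.natDegree = m)
    (hcard : f.roots.toFinset.card = m) : f.roots.Nodup ∧ Multiset.card f.roots = m := by
  have h1 : f.roots.toFinset.card ≤ Multiset.card f.roots := Multiset.toFinset_card_le _
  have h2 : Multiset.card f.roots ≤ f.natDegree := card_roots' f
  have hc : Multiset.card f.roots = m := le_antisymm (hdeg ▸ h2) (hcard ▸ h1)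
  exact ⟨Multiset.toFinset_card_eq_card_iff_nodup.1 (by rw [hc, hcard]), hc⟩

/-- If `y : Fin m → ℝ` is a strictly increasing family of roots of `f` and `f` has exactly `m` distinct roots,
then the distinct roots of `f` are exactly the `y i`. -/
theorem roots_toFinset_eq_image {f : ℝ[X]} {m : ℕ} (hcard : f.roots.toFinset.card = m)
    {y : Fin m → ℝ} (hy : StrictMono y) (hmem : ∀ i, y i ∈ f.roots.toFinset) :
    f.roots.toFinset = Finset.univ.image y := by
  symm
  apply Finset.eq_of_subset_of_card_le
  · intro r hr
    obtain ⟨i', _, rfl⟩ := Finset.mem_image.1 hr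
    exact hmem i'
  · rw [hcard, Finset.card_image_of_injective _ hy.injective, Finset.card_univ, Fintype.card_fin]

/-- Counting roots above a threshold through a sorted enumeration. -/
theorem card_filter_roots_eq {f : ℝ[X]} {m : ℕ} (hcard : f.roots.toFinset.card = m)
    {y : Fin m → ℝ} (hy : StrictMono y) (hmem : ∀ i, y i ∈ f.roots.toFinset) (t : ℝ)
    (p : Fin m → Prop) [DecidablePred p] (hp : ∀ i, t < y i ↔ p i) :
    (f.roots.toFinset.filter (fun r => t < r)).card = (Finset.univ.filter p).card := by
  rw [roots_toFinset_eq_image hcard hy hmem, Finset.filter_image,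
    Finset.card_image_of_injective _ hy.injective]
  congr 1
  ext i
  simp [hp i]

/-- **Sign of a real-rooted polynomial off its roots.**  If `f ∈ ℝ[X]` has degree `m` and `m` distinct real
roots, then at a non-root `Y` the value `f(Y)` has the sign of `lc(f) · (-1)^{#{roots > Y}}`. -/
theorem eval_mul_leadingCoeff_mul_neg_one_pow_pos {f : ℝ[X]} {m : ℕ} (hdeg : f.natDegree = m)
    (hcard : f.roots.toFinset.card = m) {Y : ℝ} (hY : f.eval Y ≠ 0) :
    0 < f.eval Y * f.leadingCoeff * (-1) ^ (f.roots.toFinset.filter (fun r => Y < r)).card := by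
  obtain ⟨hnd, hc⟩ := roots_nodup_card hdeg hcard
  have hf0 : f ≠ 0 := fun h => hY (by simp [h])
  have hlc : f.leadingCoeff ≠ 0 := leadingCoeff_ne_zero.2 hf0
  have hfac : f = C f.leadingCoeff * (f.roots.map fun a => X - C a).prod :=
    (C_leadingCoeff_mul_prod_multiset_X_sub_C (by rw [hc, hdeg])).symm
  have heval : f.eval Y = f.leadingCoeff * ∏ r ∈ f.roots.toFinset, (Y - r) := by
    conv_lhs => rw [hfac]
    rw [eval_mul, eval_C, eval_multiset_prod, Finset.prod_eq_multiset_prod, Multiset.toFinset_val,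
      hnd.dedup, Multiset.map_map]
    congr 2
    exact Multiset.map_congr rfl fun r _ => by simp
  set s := f.roots.toFinset with hs
  set T := s.filter (fun r => Y < r) with hT
  have hsplit : ∏ r ∈ s, (Y - r) = (∏ r ∈ T, (Y - r)) * ∏ r ∈ s.filter (fun r => ¬ Y < r), (Y - r) :=
    (Finset.prod_filter_mul_prod_filter_not s (fun r => Y < r) _).symm
  have hpos : 0 < ∏ r ∈ s.filter (fun r => ¬ Y < r), (Y - r) := by
    refine Finset.prod_pos fun r hr => ?_
    rw [Finset.mem_filter] at hr
    have hne : r ≠ Y := by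
      rintro rfl
      exact hY ((mem_roots hf0).1 (Multiset.mem_toFinset.1 hr.1))
    have := lt_of_le_of_ne (not_lt.1 hr.2) hne
    linarith
  have hneg : ∏ r ∈ T, (Y - r) = (-1) ^ T.card * ∏ r ∈ T, (r - Y) := by
    rw [← Finset.prod_const, ← Finset.prod_mul_distrib]
    exact Finset.prod_congr rfl fun r _ => by ring
  have hpos' : 0 < ∏ r ∈ T, (r - Y) := by
    refine Finset.prod_pos fun r hr => ?_
    rw [Finset.mem_filter] at hr
    linarith [hr.2]
  rw [heval, hsplit, hneg]
  have h1 : (0:ℝ) < ((-1 : ℝ) ^ T.card) ^ 2 := by positivity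
  have h2 : (0:ℝ) < f.leadingCoeff ^ 2 := by positivity
  have key : f.leadingCoeff * ((-1) ^ T.card * (∏ r ∈ T, (r - Y)) *
        ∏ r ∈ s.filter (fun r => ¬ Y < r), (Y - r)) * f.leadingCoeff * (-1) ^ T.card
      = (f.leadingCoeff ^ 2 * ((-1 : ℝ) ^ T.card) ^ 2) *
        ((∏ r ∈ T, (r - Y)) * ∏ r ∈ s.filter (fun r => ¬ Y < r), (Y - r)) := by ring
  rw [key]
  exact mul_pos (mul_pos h2 h1) (mul_pos hpos' hpos)

/-- **Sign change across a simple root.**  With `y` the sorted roots of `f` (degree `m`, `m` distinct roots) and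
`ε > 0` smaller than half of every root gap, `f(y_i - ε)` and `f(y_i + ε)` have opposite signs. -/
theorem eval_mul_eval_neg_of_separated {f : ℝ[X]} {m : ℕ} (hdeg : f.natDegree = m)
    (hcard : f.roots.toFinset.card = m) {y : Fin m → ℝ} (hy : StrictMono y)
    (hmem : ∀ i, y i ∈ f.roots.toFinset) {ε : ℝ} (hε : 0 < ε)
    (hsep : ∀ i i', i < i' → y i + 2 * ε < y i') (i : Fin m) :
    f.eval (y i - ε) * f.eval (y i + ε) < 0 := by
  have hf0 : f ≠ 0 := by
    intro h
    rw [h, roots_zero, Multiset.toFinset_zero, Finset.card_empty] at hcard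
    exact absurd i.2 (by omega)
  have himg := roots_toFinset_eq_image hcard hy hmem
  -- the two evaluation points are not roots
  have hneP : f.eval (y i + ε) ≠ 0 := by
    intro h0
    have : y i + ε ∈ f.roots.toFinset := Multiset.mem_toFinset.2 ((mem_roots hf0).2 h0)
    rw [himg, Finset.mem_image] at this
    obtain ⟨i', _, hi'⟩ := this
    have hlt : i < i' := by
      by_contra hle
      have : y i' ≤ y i := hy.monotone (not_lt.1 hle)
      linarith
    have := hsep i i' hlt
    linarith
  have hneM : f.eval (y i - ε) ≠ 0 := by
    intro h0
    have : y i - ε ∈ f.roots.toFinset := Multiset.mem_toFinset.2 ((mem_roots hf0).2 h0)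
    rw [himg, Finset.mem_image] at this
    obtain ⟨i', _, hi'⟩ := this
    have hlt : i' < i := by
      by_contra hle
      have : y i ≤ y i' := hy.monotone (not_lt.1 hle)
      linarith
    have := hsep i' i hlt
    linarith
  -- root counts above the two points
  have hNP : (f.roots.toFinset.filter (fun r => y i + ε < r)).card =
      (Finset.univ.filter (fun i' => i < i')).card := by
    refine card_filter_roots_eq hcard hy hmem _ _ fun i' => ⟨fun h => ?_, fun h => ?_⟩
    · by_contra hle
      have : y i' ≤ y i := hy.monotone (not_lt.1 hle)
      linarith
    · have := hsep i i' h
      linarith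
  have hNM : (f.roots.toFinset.filter (fun r => y i - ε < r)).card =
      (Finset.univ.filter (fun i' => i ≤ i')).card := by
    refine card_filter_roots_eq hcard hy hmem _ _ fun i' => ⟨fun h => ?_, fun h => ?_⟩
    · by_contra hlt
      have := hsep i' i (not_le.1 hlt)
      linarith
    · have : y i ≤ y i' := hy.monotone h
      linarith
  have hset : Finset.univ.filter (fun i' : Fin m => i ≤ i') =
      insert i (Finset.univ.filter (fun i' => i < i')) := by
    ext i'
    simp only [Finset.mem_filter, Finset.mem_univ, true_and, Finset.mem_insert]
    constructor
    · intro h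
      rcases lt_or_eq_of_le h with h | h
      · exact Or.inr h
      · exact Or.inl h.symm
    · rintro (h | h)
      · exact h ▸ le_rfl
      · exact h.le
  have hcard' : (Finset.univ.filter (fun i' : Fin m => i ≤ i')).card =
      (Finset.univ.filter (fun i' => i < i')).card + 1 := by
    rw [hset, Finset.card_insert_of_notMem (by simp)]
  have hA := eval_mul_leadingCoeff_mul_neg_one_pow_pos hdeg hcard hneP
  have hB := eval_mul_leadingCoeff_mul_neg_one_pow_pos hdeg hcard hneM
  rw [hNP] at hA
  rw [hNM, hcard', pow_succ] at hB
  set σ : ℝ := (-1) ^ (Finset.univ.filter (fun i' : Fin m => i < i')).card with hσ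
  have hlc : f.leadingCoeff ≠ 0 := leadingCoeff_ne_zero.2 hf0
  have hσ0 : σ ≠ 0 := pow_ne_zero _ (by norm_num)
  have hprod := mul_pos hA hB
  have hre : f.eval (y i + ε) * f.leadingCoeff * σ * (f.eval (y i - ε) * f.leadingCoeff * (σ * -1)) =
      -(f.eval (y i - ε) * f.eval (y i + ε)) * (f.leadingCoeff ^ 2 * σ ^ 2) := by ring
  rw [hre] at hprod
  have hp2 : 0 < f.leadingCoeff ^ 2 * σ ^ 2 := by positivity
  exact neg_pos.1 ((mul_pos_iff_of_pos_right hp2).1 hprod)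

/-! ### Sorted roots of a family and their continuity -/

/-- A sorted enumeration of the distinct roots of a family `ψ` on a parameter set `U` where every member has
exactly `m` distinct roots: strictly increasing in the index, consisting of roots, and exhaustive. -/
theorem exists_sortedRoots (ψ : ℝ → ℝ[X]) (U : Set ℝ) (m : ℕ)
    (hcard : ∀ x ∈ U, (ψ x).roots.toFinset.card = m) :
    ∃ y : Fin m → ℝ → ℝ, ∀ x ∈ U, StrictMono (fun j => y j x) ∧
      (∀ j, y j x ∈ (ψ x).roots.toFinset) ∧ ∀ r ∈ (ψ x).roots.toFinset, ∃ j, y j x = r := by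
  classical
  refine ⟨fun j x => if h : (ψ x).roots.toFinset.card = m then
    (ψ x).roots.toFinset.orderEmbOfFin h j else 0, ?_⟩
  intro x hx
  have h := hcard x hx
  simp only [dif_pos h]
  refine ⟨((ψ x).roots.toFinset.orderEmbOfFin h).strictMono,
    fun j => Finset.orderEmbOfFin_mem _ h j, fun r hr => ?_⟩
  have : r ∈ Set.range ((ψ x).roots.toFinset.orderEmbOfFin h) := by
    rw [Finset.range_orderEmbOfFin]; exact hr
  obtain ⟨j, hj⟩ := this
  exact ⟨j, hj⟩

/-- **Continuity of the sorted roots.**  Let `U` be open and suppose that for every `x ∈ U` the polynomial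
`ψ x` has degree `m` and `m` distinct real roots, enumerated increasingly by `y · x`, and that `x ↦ (ψ x)(t)` is
continuous at the points of `U` for every fixed `t`.  Then every branch `x ↦ y j x` is continuous at every point
of `U`.  (IVT bracketing; no differentiability is used or obtained.) -/
theorem continuousAt_sortedRoots {ψ : ℝ → ℝ[X]} {U : Set ℝ} (hU : IsOpen U) {m : ℕ}
    (hdeg : ∀ x ∈ U, (ψ x).natDegree = m) (hcard : ∀ x ∈ U, (ψ x).roots.toFinset.card = m)
    (hsep : ∀ x₀ ∈ U, ∀ t : ℝ, ContinuousAt (fun x => (ψ x).eval t) x₀)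
    {y : Fin m → ℝ → ℝ} (hmono : ∀ x ∈ U, StrictMono (fun j => y j x))
    (hmem : ∀ x ∈ U, ∀ j, y j x ∈ (ψ x).roots.toFinset)
    {x₀ : ℝ} (hx₀ : x₀ ∈ U) (j : Fin m) : ContinuousAt (y j) x₀ := by
  rw [ContinuousAt, Metric.tendsto_nhds]
  intro ε hε
  -- Step 1: a radius `ε' ≤ ε` below half of every root gap at `x₀`
  obtain ⟨ε', hε'0, hε'ε, hgap⟩ : ∃ ε', 0 < ε' ∧ ε' ≤ ε ∧
      ∀ i i' : Fin m, i < i' → y i x₀ + 2 * ε' < y i' x₀ := by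
    have h1 : ∀ᶠ ε' in 𝓝[>] (0:ℝ), ε' ≤ ε := by
      have : Tendsto (fun ε' : ℝ => ε') (𝓝[>] 0) (𝓝 0) := tendsto_id.mono_left nhdsWithin_le_nhds
      exact (this.eventually_lt_const hε).mono fun _ h => h.le
    have h2 : ∀ᶠ ε' in 𝓝[>] (0:ℝ), ∀ p : Fin m × Fin m, p.1 < p.2 →
        y p.1 x₀ + 2 * ε' < y p.2 x₀ := by
      refine eventually_all.2 fun p => ?_
      by_cases hp : p.1 < p.2
      · have hlt : y p.1 x₀ + 2 * 0 < y p.2 x₀ := by simpa using hmono x₀ hx₀ hp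
        have ht : Tendsto (fun ε' : ℝ => y p.1 x₀ + 2 * ε') (𝓝[>] 0) (𝓝 (y p.1 x₀ + 2 * 0)) :=
          ((continuous_const.add (continuous_const.mul continuous_id)).tendsto 0).mono_left
            nhdsWithin_le_nhds
        exact (ht.eventually_lt_const hlt).mono fun _ h _ => h
      · exact Eventually.of_forall fun _ h => absurd h hp
    obtain ⟨ε', ⟨h1', h2'⟩, h3'⟩ := ((h1.and h2).and self_mem_nhdsWithin).exists
    exact ⟨ε', h3', h1', fun i i' hii' => h2' (i, i') hii'⟩
  -- Step 2: sign changes at `x₀`, persisting near `x₀`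
  have hsign : ∀ i, (ψ x₀).eval (y i x₀ - ε') * (ψ x₀).eval (y i x₀ + ε') < 0 := fun i =>
    eval_mul_eval_neg_of_separated (hdeg x₀ hx₀) (hcard x₀ hx₀) (hmono x₀ hx₀) (hmem x₀ hx₀)
      hε'0 hgap i
  have hnear : ∀ t : ℝ, (ψ x₀).eval t ≠ 0 →
      ∀ᶠ x in 𝓝 x₀, 0 < (ψ x).eval t * (ψ x₀).eval t := by
    intro t ht
    have hT : Tendsto (fun x => (ψ x).eval t * (ψ x₀).eval t) (𝓝 x₀)
        (𝓝 ((ψ x₀).eval t * (ψ x₀).eval t)) := (hsep x₀ hx₀ t).tendsto.mul_const _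
    exact hT.eventually_const_lt (mul_self_pos.2 ht)
  have h3 : ∀ᶠ x in 𝓝 x₀, x ∈ U := hU.mem_nhds hx₀
  have h4 : ∀ᶠ x in 𝓝 x₀, ∀ i : Fin m,
      0 < (ψ x).eval (y i x₀ - ε') * (ψ x₀).eval (y i x₀ - ε') ∧
        0 < (ψ x).eval (y i x₀ + ε') * (ψ x₀).eval (y i x₀ + ε') := by
    refine eventually_all.2 fun i => Eventually.and ?_ ?_
    · exact hnear _ (left_ne_zero_of_mul (hsign i).ne)
    · exact hnear _ (right_ne_zero_of_mul (hsign i).ne)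
  filter_upwards [h3, h4] with x hxU hx
  -- Step 3: at such an `x`, each bracket contains a root; these are all the roots, in order
  have hm : 0 < m := Fin.pos j
  have hx0 : ψ x ≠ 0 := by
    intro h
    have := hcard x hxU
    rw [h, roots_zero, Multiset.toFinset_zero, Finset.card_empty] at this
    omega
  have hchg : ∀ i, (ψ x).eval (y i x₀ - ε') * (ψ x).eval (y i x₀ + ε') < 0 := by
    intro i
    obtain ⟨ha, hb⟩ := hx i
    have h0 := hsign i
    rcases pos_and_pos_or_neg_and_neg_of_mul_pos ha with ⟨ha1, ha2⟩ | ⟨ha1, ha2⟩ <;>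
      rcases pos_and_pos_or_neg_and_neg_of_mul_pos hb with ⟨hb1, hb2⟩ | ⟨hb1, hb2⟩
    · exact absurd h0 (not_lt.2 (mul_pos ha2 hb2).le)
    · exact mul_neg_of_pos_of_neg ha1 hb1
    · exact mul_neg_of_neg_of_pos ha1 hb1
    · exact absurd h0 (not_lt.2 (mul_pos_of_neg_of_neg ha2 hb2).le)
  have hroot : ∀ i, ∃ r ∈ Set.Ioo (y i x₀ - ε') (y i x₀ + ε'), (ψ x).IsRoot r := fun i =>
    Census.exists_root_Ioo_of_mul_neg (ψ x) (by linarith) (hchg i)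
  choose r hrI hr using hroot
  have hrmono : StrictMono r := by
    intro i i' hii'
    have h1 := (hrI i).2
    have h2 := (hrI i').1
    have h3 := hgap i i' hii'
    linarith
  have hrmem : ∀ i, r i ∈ (ψ x).roots.toFinset := fun i =>
    Multiset.mem_toFinset.2 ((mem_roots hx0).2 (hr i))
  have hr_eq : r = fun i => (ψ x).roots.toFinset.orderEmbOfFin (hcard x hxU) i :=
    Finset.orderEmbOfFin_unique (hcard x hxU) hrmem hrmono
  have hy_eq : (fun i => y i x) = fun i => (ψ x).roots.toFinset.orderEmbOfFin (hcard x hxU) i :=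
    Finset.orderEmbOfFin_unique (hcard x hxU) (hmem x hxU) (hmono x hxU)
  have hyr : y j x = r j := by
    have := congrFun hy_eq j
    have := congrFun hr_eq j
    simp_all
  rw [hyr, Real.dist_eq, abs_sub_lt_iff]
  constructor <;> linarith [(hrI j).1, (hrI j).2]

end Summit.ValiantsHypothesis.ValiantsHypothesis.Theorems.LacunarySymmetroidMatrixDescartes.FoldLaw.Morse
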